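import Summits.HodgeConjecture.HodgeConjecture.Theorems.SignSymmetricPowersGenCoverage
import HarnessLib

/-!
# K1-B meridian package, G2 part (j): SAME FACTOR — all ι-even forms with a singular point of a given type lie on ONE
# listed prime factor of the restricted discriminant (route `SignSymmetricPowers`, item stmt-HodgeConjecture-19716)

Helper file (`--supports stmt-HodgeConjecture-19716`), answering prover-B g3's 21:17:34Z ask for the LINK-G assembly
(pair conjugacy needs: the given pair-type form `f₃` and the symmetric-`A₃` confluence's two-node member lie on the SAME
component).  Sign family `n = 3`, `γ = (−1,−1,1,1,1)`, `M` = the monomials fixed by `γ`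
(`SignSymmetricPowersGenCoverage.mem_signMonomials_iff_unitWeight` for the parity set), `singularCoeffs = V(Disc)`,
`D_M = killHom Disc = w · ∏ⱼ hⱼ^{eⱼ}` (`w` a unit, `eⱼ ≥ 1`; irreducibility / non-association of the `hⱼ` NOT needed):

* `exists_sameFactor_free` — `∃ j, ∀` `M`-supported degree-`d` `F` (`d ≥ 2`) singular at a FREE point `z`
  (`(z₀,z₁) ≠ 0 ≠ (z₂,z₃,z₄)`): `hⱼ(coeff_M F) = 0`;
* `exists_sameFactor_pi`, `exists_sameFactor_line` — the same for singular points on `Π = {x₀ = x₁ = 0}` and on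
  `L = {x₂ = x₃ = x₄ = 0}`.
Proof: the orbit family of the type (`SignSymmetricPowersGenSingularFamilies`) has an irreducible range inside
`V(D_M) = ⋃ V(hⱼ)`, hence inside one `V(hⱼ)` (prover-B's `exists_subset_zeroLocus_of_isPrime`), and contains `coeff_M F`
(block transitivity, `SignSymmetricPowersGenBlockTransit`).

Sorry-free; axioms standard; no definition, no named fact.

## References

* [GelfandKapranovZelevinsky1994] Gelfand–Kapranov–Zelevinsky, Discriminants…, Ch. 1 §1.
* [Hartshorne1977] R. Hartshorne, Algebraic Geometry, I Prop. 1.13.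
-/

noncomputable section

set_option linter.dupNamespace false

open MvPolynomial Matrix
open Literature.AlgebraicGeometry.Motives Literature.AlgebraicGeometry.Motives.UniversalHypersurface
open Literature.AlgebraicGeometry.HodgeTheory
open Literature.Computability.AlgebraicComplexity
open Summit.HodgeConjecture.HodgeConjecture.Theorems.SignSymmetricPowersGenSingularFamilies
open Summit.HodgeConjecture.HodgeConjecture.Theorems.SignSymmetricPowersGenBlockTransit
open Summit.HodgeConjecture.HodgeConjecture.Theorems.SignSymmetricPowersGenCoverage
open Summit.HodgeConjecture.HodgeConjecture.Theorems.SignSymmetricPowersMeridianOneNode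

namespace Summit.HodgeConjecture.HodgeConjecture.Theorems.SignSymmetricPowersGenSameFactor

/-- **Same factor, any reference point.**  Generic engine: for `M` the monomials fixed by `γ = (−1,−1,1,1,1)`,
`D_M = w ∏ hⱼ^{eⱼ}`, and a reference point `p ≠ 0`, there is ONE index `j` such that `hⱼ(coeff_M F) = 0` for every
`M`-supported degree-`d` form `F` (`d ≥ 2`) singular at a point `z` which an invertible matrix commuting with
`diagonal γ` moves to `p`. [cite: GelfandKapranovZelevinsky1994, Ch. 1 §1 (the discriminant hypersurface)] -/
theorem exists_sameFactor_of_transit {d : ℕ} (hd : 2 ≤ d) (M : Set (DegIndex 3 d)) [DecidablePred (· ∈ M)]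
    (hM : ∀ m : DegIndex 3 d, m ∈ M ↔ unitWeight ℂ 3 (fun i : Fin 5 => if (i : ℕ) < 2 then -1 else 1) m.1 = 1)
    {Disc : MvPolynomial (DegIndex 3 d) ℂ}
    (hV : ∀ a : DegIndex 3 d → ℂ, a ∈ singularCoeffs 3 d ↔ MvPolynomial.eval a Disc = 0)
    {m : ℕ} (w : MvPolynomial M ℂ) (hw : IsUnit w) (h : Fin m → MvPolynomial M ℂ) (e : Fin m → ℕ)
    (hfac : killHom ℂ 3 d M Disc = w * ∏ j, h j ^ e j) {p : Fin 5 → ℂ} (hp : p ≠ 0) :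
    ∃ j, ∀ F : MvPolynomial (Fin 5) ℂ, F.IsHomogeneous d → IsSupportedOn 3 d M F → ∀ z : Fin 5 → ℂ,
      (∃ N : Matrix (Fin 5) (Fin 5) ℂ,
        N * Matrix.diagonal (fun l : Fin 5 => if (l : ℕ) < 2 then (-1 : ℂ) else 1) =
          Matrix.diagonal (fun l : Fin 5 => if (l : ℕ) < 2 then (-1 : ℂ) else 1) * N ∧ IsUnit N.det ∧ N *ᵥ z = p) →
      (∀ i, MvPolynomial.eval z (pderiv i F) = 0) →
      MvPolynomial.eval (fun m' : M => coeff m'.1.1 F) (h j) = 0 := by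
  classical
  set γ : Fin 5 → ℂˣ := fun i : Fin 5 => if (i : ℕ) < 2 then -1 else 1 with hγdef
  have hγD : (Matrix.diagonal fun i : Fin 5 => (γ i : ℂ)) =
      Matrix.diagonal (fun l : Fin 5 => if (l : ℕ) < 2 then (-1 : ℂ) else 1) := by
    congr 1; funext i; rw [hγdef]; dsimp only; split_ifs <;> simp
  have aeval_eq : ∀ (x : M → ℂ) (q : MvPolynomial M ℂ), MvPolynomial.aeval x q = MvPolynomial.eval x q :=
    fun x q => DFunLike.congr_fun (coe_aeval_eq_eval x) q
  obtain ⟨r, v, hvh, hvM, hvp, hspan⟩ := exists_spanning_family M p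
  -- the orbit family's range `R`: prime vanishing ideal, inside `V(D_M) = ⋃ V(h j)`
  set R : Set (M → ℂ) :=
    Set.range (fun x : ((Fin 5 × Fin 5) ⊕ Fin r) → ℂ => fun m : M =>
      MvPolynomial.aeval x (coeff m.1.1 (linSubst (Fin 5) (MvPolynomial (((Fin 5 × Fin 5)) ⊕ Fin r) ℂ)
        (Matrix.of fun k l => if γ k = γ l then X (Sum.inl (k, l)) else 0)
        (∑ t, (X (Sum.inr t) : MvPolynomial (((Fin 5 × Fin 5)) ⊕ Fin r) ℂ) •
          MvPolynomial.map (C : ℂ →+* MvPolynomial (((Fin 5 × Fin 5)) ⊕ Fin r) ℂ) (v t))))) with hR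
  have hRprime : (vanishingIdeal ℂ R).IsPrime := isPrime_vanishingIdeal_range_orbitFamily γ M v
  have hDmem : killHom ℂ 3 d M Disc ∈ vanishingIdeal ℂ R :=
    killHom_mem_vanishingIdeal_range_orbitFamily (γ := γ) (M := M) (v := v) hd hM hV hp hvh hvM hvp
  have hsub : ∀ x ∈ R, ∃ j, MvPolynomial.aeval x (h j) = 0 := by
    intro x hx
    have hD := (mem_vanishingIdeal_iff.mp hDmem) x hx
    rw [aeval_eq, hfac, map_mul, map_prod] at hD
    rcases mul_eq_zero.mp hD with h1 | h1
    · exact absurd h1 (hw.map (MvPolynomial.eval x)).ne_zero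
    · obtain ⟨j, -, hj⟩ := Finset.prod_eq_zero_iff.mp h1
      rw [map_pow] at hj
      exact ⟨j, by rw [aeval_eq]; exact (pow_eq_zero_iff'.mp hj).1⟩
  obtain ⟨j₀, hj₀⟩ := SignSymmetricPowersMeridianIrreducible.exists_subset_zeroLocus_of_isPrime hRprime h hsub
  refine ⟨j₀, fun F hF hFM z ⟨N, hN, hNdet, hNz⟩ hFz => ?_⟩
  have hmem : (fun m' : M => coeff m'.1.1 F) ∈ R := by
    rw [← hγD] at hN
    exact mem_range_orbitFamily_of_transit (γ := γ) (M := M) (v := v) hM hspan hF hFM hFz hN hNdet hNz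
  have := hj₀ _ hmem
  rwa [aeval_eq] at this

/-- **SAME FACTOR (free points)** — prover-B's LINK-G ask, verbatim shape: there is ONE index `j` such that every
`M`-supported degree-`d` form singular at a free point (`(z₀,z₁) ≠ 0`, `(z₂,z₃,z₄) ≠ 0`) lies on `V(hⱼ)`.
[cite: GelfandKapranovZelevinsky1994, Ch. 1 §1 (the discriminant hypersurface)] -/
theorem exists_sameFactor_free {d : ℕ} (hd : 2 ≤ d) (M : Set (DegIndex 3 d)) [DecidablePred (· ∈ M)]
    (hM : ∀ m : DegIndex 3 d, m ∈ M ↔ unitWeight ℂ 3 (fun i : Fin 5 => if (i : ℕ) < 2 then -1 else 1) m.1 = 1)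
    {Disc : MvPolynomial (DegIndex 3 d) ℂ}
    (hV : ∀ a : DegIndex 3 d → ℂ, a ∈ singularCoeffs 3 d ↔ MvPolynomial.eval a Disc = 0)
    {m : ℕ} (w : MvPolynomial M ℂ) (hw : IsUnit w) (h : Fin m → MvPolynomial M ℂ) (e : Fin m → ℕ)
    (hfac : killHom ℂ 3 d M Disc = w * ∏ j, h j ^ e j) :
    ∃ j, ∀ F : MvPolynomial (Fin 5) ℂ, F.IsHomogeneous d → IsSupportedOn 3 d M F → ∀ z : Fin 5 → ℂ,
      (z 0 ≠ 0 ∨ z 1 ≠ 0) → (z 2 ≠ 0 ∨ z 3 ≠ 0 ∨ z 4 ≠ 0) → (∀ i, MvPolynomial.eval z (pderiv i F) = 0) →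
      MvPolynomial.eval (fun m' : M => coeff m'.1.1 F) (h j) = 0 := by
  have hq : (![1, 0, 1, 0, 0] : Fin 5 → ℂ) ≠ 0 := fun h0 =>
    one_ne_zero (congr_fun h0 0 : (![1, 0, 1, 0, 0] : Fin 5 → ℂ) 0 = 0)
  obtain ⟨j, hj⟩ := exists_sameFactor_of_transit hd M hM hV w hw h e hfac hq
  exact ⟨j, fun F hF hFM z h01 h234 hFz => hj F hF hFM z (exists_commute_mulVec_eq_free z h01 h234) hFz⟩

/-- **SAME FACTOR (points of `Π`)**: one index `j` with `hⱼ(coeff_M F) = 0` for every `M`-supported degree-`d` form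
`F` singular at a point `z = (0,0,z₂,z₃,z₄) ≠ 0`. [cite: GelfandKapranovZelevinsky1994, Ch. 1 §1 (the discriminant hypersurface)] -/
theorem exists_sameFactor_pi {d : ℕ} (hd : 2 ≤ d) (M : Set (DegIndex 3 d)) [DecidablePred (· ∈ M)]
    (hM : ∀ m : DegIndex 3 d, m ∈ M ↔ unitWeight ℂ 3 (fun i : Fin 5 => if (i : ℕ) < 2 then -1 else 1) m.1 = 1)
    {Disc : MvPolynomial (DegIndex 3 d) ℂ}
    (hV : ∀ a : DegIndex 3 d → ℂ, a ∈ singularCoeffs 3 d ↔ MvPolynomial.eval a Disc = 0)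
    {m : ℕ} (w : MvPolynomial M ℂ) (hw : IsUnit w) (h : Fin m → MvPolynomial M ℂ) (e : Fin m → ℕ)
    (hfac : killHom ℂ 3 d M Disc = w * ∏ j, h j ^ e j) :
    ∃ j, ∀ F : MvPolynomial (Fin 5) ℂ, F.IsHomogeneous d → IsSupportedOn 3 d M F → ∀ z : Fin 5 → ℂ,
      z 0 = 0 → z 1 = 0 → (z 2 ≠ 0 ∨ z 3 ≠ 0 ∨ z 4 ≠ 0) → (∀ i, MvPolynomial.eval z (pderiv i F) = 0) →
      MvPolynomial.eval (fun m' : M => coeff m'.1.1 F) (h j) = 0 := by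
  have hq : (![0, 0, 0, 0, 1] : Fin 5 → ℂ) ≠ 0 := fun h0 =>
    one_ne_zero (congr_fun h0 4 : (![0, 0, 0, 0, 1] : Fin 5 → ℂ) 4 = 0)
  obtain ⟨j, hj⟩ := exists_sameFactor_of_transit hd M hM hV w hw h e hfac hq
  exact ⟨j, fun F hF hFM z h0 h1 h234 hFz => hj F hF hFM z (exists_commute_mulVec_eq_pi z h0 h1 h234) hFz⟩

/-- **SAME FACTOR (points of `L`)**: one index `j` with `hⱼ(coeff_M F) = 0` for every `M`-supported degree-`d` form
`F` singular at a point `z = (z₀,z₁,0,0,0) ≠ 0`. [cite: GelfandKapranovZelevinsky1994, Ch. 1 §1 (the discriminant hypersurface)] -/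
theorem exists_sameFactor_line {d : ℕ} (hd : 2 ≤ d) (M : Set (DegIndex 3 d)) [DecidablePred (· ∈ M)]
    (hM : ∀ m : DegIndex 3 d, m ∈ M ↔ unitWeight ℂ 3 (fun i : Fin 5 => if (i : ℕ) < 2 then -1 else 1) m.1 = 1)
    {Disc : MvPolynomial (DegIndex 3 d) ℂ}
    (hV : ∀ a : DegIndex 3 d → ℂ, a ∈ singularCoeffs 3 d ↔ MvPolynomial.eval a Disc = 0)
    {m : ℕ} (w : MvPolynomial M ℂ) (hw : IsUnit w) (h : Fin m → MvPolynomial M ℂ) (e : Fin m → ℕ)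
    (hfac : killHom ℂ 3 d M Disc = w * ∏ j, h j ^ e j) :
    ∃ j, ∀ F : MvPolynomial (Fin 5) ℂ, F.IsHomogeneous d → IsSupportedOn 3 d M F → ∀ z : Fin 5 → ℂ,
      (z 0 ≠ 0 ∨ z 1 ≠ 0) → z 2 = 0 → z 3 = 0 → z 4 = 0 → (∀ i, MvPolynomial.eval z (pderiv i F) = 0) →
      MvPolynomial.eval (fun m' : M => coeff m'.1.1 F) (h j) = 0 := by
  have hq : (![1, 0, 0, 0, 0] : Fin 5 → ℂ) ≠ 0 := fun h0 =>
    one_ne_zero (congr_fun h0 0 : (![1, 0, 0, 0, 0] : Fin 5 → ℂ) 0 = 0)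
  obtain ⟨j, hj⟩ := exists_sameFactor_of_transit hd M hM hV w hw h e hfac hq
  exact ⟨j, fun F hF hFM z h01 h2 h3 h4 hFz => hj F hF hFM z (exists_commute_mulVec_eq_line z h01 h2 h3 h4) hFz⟩

end Summit.HodgeConjecture.HodgeConjecture.Theorems.SignSymmetricPowersGenSameFactor

end
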